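import Summits.KontsevichZagierPeriods.Zeta5Search.Barrier.ConeGammaLogCuspExplicit
import Summits.KontsevichZagierPeriods.Zeta5Search.Barrier.ConeGammaCuspSlopeLipschitz

/-!
# ζ(5) search — BARRIER: the LOG-CUSP EXPANSION IS UNIFORM IN THE DISPLACEMENT — one constant, one radius, on a whole ball

HONEST FRAMING (cell `pub-zeta5`): systematic search; no irrationality claim unless kernel-certified. MODEL objects
under Brown–Zudilin's (28)+(30) accounting ([BZ22] = arXiv:2210.03391; (28) observed, not proved); nothing here is a
statement about `ζ(5)`, any `γ` of record, the cone's supremum (C2 = `BarrierC2` OPEN) or the value / sign of the cusp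
slope at a named direction (DATA of the cell); the lemma S-E stays CONJECTURED (see «NOT here» below); records in print
UNMOVED. Prover P2 g37 (P2 g36's successor menu (a) «Λ controls the saving to first order — the UNIFORM-in-δ
remainder is the real item»), file (1b) of three (theorems only).

THE POINT. File (1a) (`ConeGammaLogCuspExplicit`) wrote the constants of P2 g19's log-cusp expansion out; they are
MONOTONE in the shift size `Y(δ) = max_k |φ_k(δ)|` (and `|σ(δ)| ≤ 28·T·Y(δ)`, P2 g29's `abs_cuspSlope_le`). Hence:
* `clusterWidth_le_of_shiftSize_le`, `clusterBound_le_of_shiftSize_le`, **`exists_admissible_scale_uniform`** — ONE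
  scale `ρ > 0` admissible (Lemma B's `ρK < 1`, `ρK < d`, `2ρW ≤` every breakpoint gap) for EVERY `δ` with
  `Y(δ) ≤ Y₀`;
* **`phi30_logCusp_uniform`** — THE UNIFORM LOG-CUSP EXPANSION: for every `Y₀ ≥ 0` there are `C, ε₁ > 0` (depending
  on `a`, `T`, `Y₀` only) with `|Φ(s(a)+εδ) − Φ(s(a)) − (σ(δ)/T)·ε·log(1/ε)| ≤ C·ε` for ALL `δ` with `Y(δ) ≤ Y₀` and
  all `0 < ε ≤ ε₁` (displaced direction in the closed box);
* **`phi30_logCusp_nhds`** — THE NEIGHBOURHOOD FORM (degree-1 homogeneity `cuspSlope_smul` absorbs `ε`): there are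
  `C, r > 0` with **`|Φ(s(a)+η) − Φ(s(a)) − (σ(η)/T)·log(1/Y(η))| ≤ C·Y(η)`** for EVERY displacement `η` with
  `0 < Y(η) ≤ r` (and `s(a)+η` in the closed box) — the MODEL saving on a whole `Y`-ball around a rational direction
  is its value plus the degree-1 cusp term with the EXACT coefficient `σ(η)/T`, up to `O(Y(η))` with ONE constant;
* `abs_apply_zero/succ_le_shiftSize`, `BZBox_perturb_of_shiftSize_le`, **`phi30_logCusp_nhds_openBox`** — on the
  OPEN box the box condition is automatic on a `Y`-ball (`|η₀| ≤ (3/2)Y(η)`, `|η_j| ≤ (5/2)Y(η)`), so the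
  neighbourhood form holds for every `η` with `0 < Y(η) ≤ r`, unconditionally;
* displacement geometry for file (2): `sParam_zero_pos` (`s₀ > 0`), **`shiftSize_le_mul_spread_of_apply_zero`** — ON
  THE SLICE `{η₀ = 0}` THE RATE SPREAD IS A NORM: `Y(η) ≤ (x_max + 3x_max²/(2s₀))·(r_M(η) − r_m(η))` (a displacement
  within spread `S` of the radial line is `c•s(a) + θ` with `Y(θ) ≤ S·x_max`, and `η₀ = 0` pins `|c|·s₀ ≤
  (3/2)·S·x_max`), `norm_le_shiftSize` (`‖η‖ ≤ (5/2)Y(η)`), `shiftSize_le_two_mul_norm` (`Y(η) ≤ 2‖η‖`).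
NOT here (honest): the radius `r` is the COHERENCE radius of Lemma B (through `wallDist a T` and the least breakpoint
gap of the period; DATA at the four named directions in `HOME/pub-zeta5-p2/g37/alg/radius.json`: the certified sup-norm
ball has radius `4.1e−5 · 3.8e−5 · 9.7e−6 · 6.0e−7` at record/41 · flag/60 · argmax-120 · t*/480, SHORT of S-E's
covering radius `1/(2λ₀)` by factors `297 · 440 · 859 · 3470`, with `C ≈ 5e6 … 2e8`) — this ball is Lemma B's
coherence ball, not S-E's covering ball: the lemma S-E of `BARRIER-PLAN.md` §2b, whose content is exactly the passage to
the ball of radius `1/(2λ₀)` with an `O(1)` constant, stays CONJECTURED; no radius, constant, value or sign of `σ` at any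
named direction enters a statement; nothing about `γ`, C2 or `ζ(5)`. File (2)
(`ConeGammaCuspModulusLocal`) reads the ball expansion through P2 g36's global ascent modulus `Λ`.
-/

noncomputable section

open Set MeasureTheory
open scoped Topology

namespace Summit.KontsevichZagierPeriods.Zeta5Search.Barrier.ConeGamma

/-! ### One admissible scale for every displacement of bounded size -/

/-- The cluster half-width is monotone in the shift size: `Y(δ) ≤ Y₀ ⇒ W(δ) ≤ Y₀/x_min + 1`. -/
theorem clusterWidth_le_of_shiftSize_le {a : Dir} (hpos : ∀ k, 0 < h28 a k) {δ : Fin 8 → ℝ} {Y₀ : ℝ}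
    (h : shiftSize δ ≤ Y₀) : clusterWidth a δ ≤ Y₀ / xMin a + 1 := by
  unfold clusterWidth
  have := div_le_div_of_nonneg_right h (xMin_pos hpos).le
  linarith

/-- The cluster bound is monotone in the shift size: `Y(δ) ≤ Y₀ ⇒ K(δ) ≤ (Y₀/x_min + 1)·x_max + Y₀`. -/
theorem clusterBound_le_of_shiftSize_le {a : Dir} (hpos : ∀ k, 0 < h28 a k) {δ : Fin 8 → ℝ} {Y₀ : ℝ}
    (h : shiftSize δ ≤ Y₀) : clusterBound a δ ≤ (Y₀ / xMin a + 1) * xMax a + Y₀ := by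
  unfold clusterBound
  have := mul_le_mul_of_nonneg_right (clusterWidth_le_of_shiftSize_le hpos h) (xMax_pos hpos).le
  linarith

/-- **ONE ADMISSIBLE SCALE FOR ALL DISPLACEMENTS OF SIZE `≤ Y₀`.** All 28 forms of `a` positive, `T > 0`, `Y₀ ≥ 0`:
there is `ρ > 0` satisfying the three hypotheses of Lemma B (`ρK(δ) < 1`, `ρK(δ) < d`, `2ρW(δ) ≤` every breakpoint
gap of `[0, T]`) SIMULTANEOUSLY for every `δ` with `Y(δ) ≤ Y₀` — the scale of `exists_admissible_scale` for the
majorants `W₀ = Y₀/x_min + 1`, `K₀ = W₀·x_max + Y₀` of the cluster data. -/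
theorem exists_admissible_scale_uniform {a : Dir} (hpos : ∀ k, 0 < h28 a k) {T : ℝ} (hT : 0 < T) {Y₀ : ℝ}
    (hY₀ : 0 ≤ Y₀) :
    ∃ ρ : ℝ, 0 < ρ ∧ ∀ δ : Fin 8 → ℝ, shiftSize δ ≤ Y₀ →
      ρ * clusterBound a δ < 1 ∧ ρ * clusterBound a δ < wallDist a T ∧
        ∀ m, m + 1 < (bkpts a T).card → 2 * ρ * clusterWidth a δ ≤ bkpt a T (m + 1) - bkpt a T m := by
  have hxm := xMin_pos hpos
  have hxM := xMax_pos hpos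
  obtain ⟨W₀, hW₀⟩ : ∃ W₀ : ℝ, W₀ = Y₀ / xMin a + 1 := ⟨_, rfl⟩
  obtain ⟨K₀, hK₀⟩ : ∃ K₀ : ℝ, K₀ = W₀ * xMax a + Y₀ := ⟨_, rfl⟩
  have hW : 0 < W₀ := by rw [hW₀]; have := div_nonneg hY₀ hxm.le; linarith
  have hK : 0 < K₀ := by rw [hK₀]; have := mul_pos hW hxM; linarith
  have hd := wallDist_pos a T
  have hc := two_le_card_bkpts a hT
  have hne : (Finset.range ((bkpts a T).card - 1)).Nonempty := ⟨0, Finset.mem_range.mpr (by omega)⟩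
  -- the smallest breakpoint gap
  obtain ⟨g, hgpos, hgle⟩ : ∃ g : ℝ, 0 < g ∧ ∀ m, m + 1 < (bkpts a T).card → g ≤ bkpt a T (m + 1) - bkpt a T m := by
    refine ⟨(Finset.range ((bkpts a T).card - 1)).inf' hne fun m => bkpt a T (m + 1) - bkpt a T m, ?_,
      fun m hm => Finset.inf'_le _ (Finset.mem_range.mpr (by omega))⟩
    rw [Finset.lt_inf'_iff]
    intro m hm
    rw [Finset.mem_range] at hm
    exact sub_pos.mpr (bkpt_strictMono (Nat.lt_succ_self m) (by omega))
  have hρpos : 0 < min (min (1 / (2 * K₀)) (wallDist a T / (2 * K₀))) (g / (2 * W₀)) :=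
    lt_min (lt_min (div_pos one_pos (by linarith)) (div_pos hd (by linarith))) (div_pos hgpos (by linarith))
  refine ⟨min (min (1 / (2 * K₀)) (wallDist a T / (2 * K₀))) (g / (2 * W₀)), hρpos, fun δ hδ => ?_⟩
  have hKδ := clusterBound_pos hpos δ
  have hWδ := clusterWidth_pos hpos δ
  have hKle : clusterBound a δ ≤ K₀ := by rw [hK₀, hW₀]; exact clusterBound_le_of_shiftSize_le hpos hδ
  have hWle : clusterWidth a δ ≤ W₀ := by rw [hW₀]; exact clusterWidth_le_of_shiftSize_le hpos hδ
  refine ⟨?_, ?_, fun m hm => ?_⟩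
  · calc _ ≤ (1 / (2 * K₀)) * K₀ :=
        mul_le_mul ((min_le_left _ _).trans (min_le_left _ _)) hKle hKδ.le (div_nonneg one_pos.le (by linarith))
      _ = 1 / 2 := by field_simp
      _ < 1 := by norm_num
  · calc _ ≤ (wallDist a T / (2 * K₀)) * K₀ :=
        mul_le_mul ((min_le_left _ _).trans (min_le_right _ _)) hKle hKδ.le (div_nonneg hd.le (by linarith))
      _ = wallDist a T / 2 := by field_simp
      _ < wallDist a T := by linarith
  · calc _ ≤ 2 * (g / (2 * W₀)) * W₀ := by
          have := min_le_right (min (1 / (2 * K₀)) (wallDist a T / (2 * K₀))) (g / (2 * W₀))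
          have hgw : 0 ≤ g / (2 * W₀) := div_nonneg hgpos.le (by linarith)
          nlinarith
      _ = g := by field_simp
      _ ≤ _ := hgle m hm

/-! ### The uniform expansion -/

/-- `|σ(δ)| ≤ 28·T·Y(δ)` (P2 g29's `abs_cuspSlope_le` with `Σ_k |φ_k(δ)| ≤ 28·Y(δ)`). -/
theorem abs_cuspSlope_le_shiftSize {a : Dir} (hpos : ∀ k, 0 < h28 a k) {T : ℝ} (hT : 0 < T)
    (hper : ∀ k : Fin 28, ∃ z : ℤ, T * h28 a k = z) (δ : Fin 8 → ℝ) :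
    |cuspSlope a T δ| ≤ 28 * T * shiftSize δ := by
  have h := abs_cuspSlope_sub_le_shiftSize hpos hT hper δ 0
  rwa [cuspSlope_zero, sub_zero, sub_zero] at h

/-- **THE UNIFORM LOG-CUSP EXPANSION.** All 28 forms of `a` positive, `a` in the closed box, `T > 0` a period,
`Y₀ ≥ 0`. There are `C` and `ε₁ > 0` — depending on `a`, `T`, `Y₀` ONLY — such that for EVERY displacement `δ` with
`Y(δ) = max_k |φ_k(δ)| ≤ Y₀` and every `0 < ε ≤ ε₁` with `s(a) + εδ` in the closed box:
`|Φ(s(a)+εδ) − Φ(s(a)) − (cuspSlope a T δ / T)·ε·log(1/ε)| ≤ C·ε`.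
(`ρ` = the uniform admissible scale; `ε₁ = min(ρ/(2T), 1/(T·Y₀+1), x_min/(2Y₀+1))`; `C` = the explicit constant at
`Y₀` with `|σ| ≤ 28·T·Y₀`.) P2 g19's per-displacement `C(δ), ε₁(δ)` are thereby ONE pair on every `Y`-bounded set. -/
theorem phi30_logCusp_uniform {a : Dir} (ha : BZBox a) (hpos : ∀ k, 0 < h28 a k) {T : ℝ} (hT : 0 < T)
    (hper : ∀ k : Fin 28, ∃ z : ℤ, T * h28 a k = z) {Y₀ : ℝ} (hY₀ : 0 ≤ Y₀) :
    ∃ C ε₁ : ℝ, 0 < ε₁ ∧ ∀ δ : Fin 8 → ℝ, shiftSize δ ≤ Y₀ → ∀ ε, 0 < ε → ε ≤ ε₁ →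
      BZBox (aOfS (sParam a + ε • δ)) →
        |phi30 (aOfS (sParam a + ε • δ)) - phi30 a - cuspSlope a T δ / T * ε * Real.log (1 / ε)| ≤ C * ε := by
  have hxm := xMin_pos hpos
  have hxM := xMax_pos hpos
  obtain ⟨ρ, hρ, hadm⟩ := exists_admissible_scale_uniform hpos hT hY₀
  obtain ⟨C₁, hC₁⟩ : ∃ C₁ : ℝ, C₁ = 392 * Y₀ * (T * xMax a + 5) / xMin a := ⟨_, rfl⟩
  obtain ⟨Clog, hClog⟩ : ∃ Clog : ℝ, Clog = 1 + Real.log 2 + |Real.log (ρ / T)| := ⟨_, rfl⟩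
  have hClog0 : 0 ≤ Clog := by
    rw [hClog]; have := Real.log_pos one_lt_two; have := abs_nonneg (Real.log (ρ / T)); linarith
  refine ⟨(2 * xMax a) ^ 2 * T * C₁ + 4 * C₁ / T + 28 * T * Y₀ / T * Clog + 14 / ρ,
    min (ρ / (2 * T)) (min (1 / (T * Y₀ + 1)) (xMin a / (2 * Y₀ + 1))),
    lt_min (div_pos hρ (by linarith)) (lt_min (div_pos one_pos (by nlinarith)) (div_pos hxm (by linarith))),
    fun δ hδ ε hε hεle haε => ?_⟩
  have hY := shiftSize_nonneg δ
  obtain ⟨h1, h2, hgap⟩ := hadm δ hδ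
  -- the three smallness conditions on ε
  have hεa : ε * T ≤ ρ / 2 := by
    have : ε ≤ ρ / (2 * T) := hεle.trans (min_le_left _ _)
    rw [le_div_iff₀ (by linarith)] at this; linarith
  have hεY : ε * shiftSize δ ≤ ε * Y₀ := mul_le_mul_of_nonneg_left hδ hε.le
  have hεb : ε * T * shiftSize δ ≤ 1 := by
    have h : ε ≤ 1 / (T * Y₀ + 1) := hεle.trans ((min_le_right _ _).trans (min_le_left _ _))
    rw [le_div_iff₀ (by nlinarith)] at h
    have := mul_le_mul_of_nonneg_left hεY hT.le
    nlinarith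
  have hεc : ε * shiftSize δ ≤ xMin a / 2 := by
    have h : ε ≤ xMin a / (2 * Y₀ + 1) := hεle.trans ((min_le_right _ _).trans (min_le_right _ _))
    rw [le_div_iff₀ (by linarith)] at h
    nlinarith
  -- the explicit expansion at the uniform scale, and the comparison of constants
  have hmain := phi30_logCusp_explicit ha hpos hT hper δ hρ h1 h2 hgap hε hεa hεb hεc haε
  obtain ⟨c₁, hc₁⟩ : ∃ c₁ : ℝ, c₁ = 392 * shiftSize δ * (T * xMax a + 5) / xMin a := ⟨_, rfl⟩
  rw [← hc₁, ← hClog] at hmain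
  refine hmain.trans (mul_le_mul_of_nonneg_right ?_ hε.le)
  have hc₁le : c₁ ≤ C₁ := by
    rw [hc₁, hC₁]
    refine div_le_div_of_nonneg_right ?_ hxm.le
    have h5 : 0 ≤ T * xMax a + 5 := by nlinarith
    nlinarith [mul_le_mul_of_nonneg_right hδ h5]
  have hA : (2 * xMax a) ^ 2 * T * c₁ ≤ (2 * xMax a) ^ 2 * T * C₁ :=
    mul_le_mul_of_nonneg_left hc₁le (by positivity)
  have hB : 4 * c₁ / T ≤ 4 * C₁ / T := div_le_div_of_nonneg_right (by linarith) hT.le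
  have hσ : |cuspSlope a T δ| / T * Clog ≤ 28 * T * Y₀ / T * Clog := by
    refine mul_le_mul_of_nonneg_right (div_le_div_of_nonneg_right ?_ hT.le) hClog0
    exact (abs_cuspSlope_le_shiftSize hpos hT hper δ).trans (by nlinarith)
  linarith

/-! ### The neighbourhood form: one constant on a whole `Y`-ball -/

/-- **THE LOG-CUSP EXPANSION ON A BALL (neighbourhood form).** All 28 forms of `a` positive, `a` in the closed box,
`T > 0` a period. There are `C` and a radius `r > 0` — depending on `a`, `T` only — such that for EVERY displacement
`η` with `0 < Y(η) ≤ r` and `s(a) + η` in the closed box: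
`|Φ(s(a)+η) − Φ(s(a)) − (cuspSlope a T η / T)·log(1/Y(η))| ≤ C·Y(η)`.
(The uniform expansion at `Y₀ = 1` applied to `δ = Y(η)⁻¹•η`, `ε = Y(η)`; the degree-1 homogeneity `σ(ε•δ) =
ε·σ(δ)` of `cuspSlope_smul` absorbs the scale.) So on the whole `Y`-ball of radius `r` the MODEL saving is its value at
the rational direction plus the cusp term with the EXACT coefficient `σ(η)/T`, up to `O(Y(η))` with ONE constant. This
ball is Lemma B's coherence ball, not S-E's covering ball of radius `1/(2λ₀)` (S-E stays CONJECTURED; see the module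
docstring for the sizes, which are DATA and enter no statement). -/
theorem phi30_logCusp_nhds {a : Dir} (ha : BZBox a) (hpos : ∀ k, 0 < h28 a k) {T : ℝ} (hT : 0 < T)
    (hper : ∀ k : Fin 28, ∃ z : ℤ, T * h28 a k = z) :
    ∃ C r : ℝ, 0 < r ∧ ∀ η : Fin 8 → ℝ, 0 < shiftSize η → shiftSize η ≤ r →
      BZBox (aOfS (sParam a + η)) →
        |phi30 (aOfS (sParam a + η)) - phi30 a - cuspSlope a T η / T * Real.log (1 / shiftSize η)|
          ≤ C * shiftSize η := by
  obtain ⟨C, ε₁, hε₁, h⟩ := phi30_logCusp_uniform ha hpos hT hper zero_le_one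
  refine ⟨C, ε₁, hε₁, fun η hY hYr hbox => ?_⟩
  have hY0 : shiftSize η ≠ 0 := hY.ne'
  have hδ1 : shiftSize ((shiftSize η)⁻¹ • η) ≤ 1 := by
    rw [shiftSize_smul, abs_of_pos (inv_pos.mpr hY), inv_mul_cancel₀ hY0]
  have hηeq : shiftSize η • ((shiftSize η)⁻¹ • η) = η := by
    rw [smul_smul, mul_inv_cancel₀ hY0, one_smul]
  have hmain := h _ hδ1 (shiftSize η) hY hYr (by rw [hηeq]; exact hbox)
  rw [hηeq] at hmain
  have hσ' : cuspSlope a T η = shiftSize η * cuspSlope a T ((shiftSize η)⁻¹ • η) := by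
    rw [← cuspSlope_smul hpos hT hper _ hY, hηeq]
  have hσ : cuspSlope a T ((shiftSize η)⁻¹ • η) / T * shiftSize η = cuspSlope a T η / T := by
    rw [hσ']; ring
  rwa [hσ] at hmain

/-! ### The open box: the ball expansion with no side condition -/

/-- A displacement's `0`-th coordinate is controlled by its shift size: `|η₀| ≤ (3/2)·Y(η)`
(`2η₀ = (η₀ − η₁) + (η₀ − η₂) + (η₁ + η₂)`, three pair forms). -/
theorem abs_apply_zero_le_shiftSize (η : Fin 8 → ℝ) : |η 0| ≤ 3 / 2 * shiftSize η := by
  have h1 := abs_pairForm_le_shiftSize η (show (0 : Fin 8) ≠ 1 by decide)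
  have h2 := abs_pairForm_le_shiftSize η (show (0 : Fin 8) ≠ 2 by decide)
  have h3 := abs_pairForm_le_shiftSize η (show (1 : Fin 8) ≠ 2 by decide)
  have e : 2 * η 0 = pairForm η 0 1 + pairForm η 0 2 + pairForm η 1 2 := by
    simp [pairForm]; ring
  rw [abs_le] at h1 h2 h3 ⊢
  constructor <;> linarith [h1.1, h1.2, h2.1, h2.2, h3.1, h3.2]

/-- Every other coordinate is controlled as well: `|η_{j+1}| ≤ (5/2)·Y(η)` (`η_{j+1} = η₀ − (η₀ − η_{j+1})`). -/
theorem abs_apply_succ_le_shiftSize (η : Fin 8 → ℝ) (j : Fin 7) : |η j.succ| ≤ 5 / 2 * shiftSize η := by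
  have h0 := abs_apply_zero_le_shiftSize η
  have h1 := abs_pairForm_le_shiftSize η (show (0 : Fin 8) ≠ j.succ from (Fin.succ_ne_zero j).symm)
  have e : pairForm η 0 j.succ = η 0 - η j.succ := by simp [pairForm]
  rw [e] at h1
  rw [abs_le] at h0 h1 ⊢
  constructor <;> linarith [h0.1, h0.2, h1.1, h1.2]

/-- **On the OPEN box, every `Y`-small displacement keeps the direction in the closed box**: for `0 < s_j(a) <
s₀(a)` (`j = 1..7`) there is `r₁ > 0` with `aOfS (s(a) + η)` in the closed box whenever `Y(η) ≤ r₁`. -/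
theorem BZBox_perturb_of_shiftSize_le {a : Dir}
    (hj : ∀ j : Fin 7, 0 < sParam a j.succ ∧ sParam a j.succ < sParam a 0) :
    ∃ r₁ : ℝ, 0 < r₁ ∧ ∀ η : Fin 8 → ℝ, shiftSize η ≤ r₁ → BZBox (aOfS (sParam a + η)) := by
  -- the margin `m` of the open box
  obtain ⟨m, hm, hms, hms0⟩ : ∃ m : ℝ, 0 < m ∧ (∀ j : Fin 7, m ≤ sParam a j.succ) ∧
      ∀ j : Fin 7, m ≤ sParam a 0 - sParam a j.succ := by
    refine ⟨(Finset.univ : Finset (Fin 7)).inf' Finset.univ_nonempty fun j =>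
      min (sParam a j.succ) (sParam a 0 - sParam a j.succ), ?_, fun j => ?_, fun j => ?_⟩
    · rw [Finset.lt_inf'_iff]
      exact fun j _ => lt_min (hj j).1 (sub_pos.mpr (hj j).2)
    · exact (Finset.inf'_le _ (Finset.mem_univ j)).trans (min_le_left _ _)
    · exact (Finset.inf'_le _ (Finset.mem_univ j)).trans (min_le_right _ _)
  refine ⟨m / 5, by linarith, fun η hY => ?_⟩
  have h0 := abs_le.mp ((abs_apply_zero_le_shiftSize η).trans (by linarith : 3 / 2 * shiftSize η ≤ m / 2))
  have hsucc : ∀ j : Fin 7, |η j.succ| ≤ m / 2 := fun j =>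
    (abs_apply_succ_le_shiftSize η j).trans (by linarith)
  have hs1 : m ≤ sParam a 1 := hms 0
  have hs10 : m ≤ sParam a 0 - sParam a 1 := hms0 0
  unfold BZBox
  rw [sParam_aOfS]
  simp only [Pi.add_apply]
  refine ⟨by linarith [h0.1, (hj 0).1], fun j => ⟨?_, ?_⟩⟩
  · have := abs_le.mp (hsucc j); have := hms j; linarith
  · have := abs_le.mp (hsucc j); have := hms0 j; linarith

/-- **THE LOG-CUSP EXPANSION ON A BALL, OPEN BOX** (no side condition on the displaced direction): for `a` with
`0 < s_j(a) < s₀(a)` (`j = 1..7`) and a period `T` there are `C` and `r > 0` with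
`|Φ(s(a)+η) − Φ(s(a)) − (cuspSlope a T η / T)·log(1/Y(η))| ≤ C·Y(η)` for EVERY `η` with `0 < Y(η) ≤ r`. -/
theorem phi30_logCusp_nhds_openBox {a : Dir}
    (hopen : ∀ j : Fin 7, 0 < sParam a j.succ ∧ sParam a j.succ < sParam a 0)
    {T : ℝ} (hT : 0 < T) (hper : ∀ k : Fin 28, ∃ z : ℤ, T * h28 a k = z) :
    ∃ C r : ℝ, 0 < r ∧ ∀ η : Fin 8 → ℝ, 0 < shiftSize η → shiftSize η ≤ r →
      |phi30 (aOfS (sParam a + η)) - phi30 a - cuspSlope a T η / T * Real.log (1 / shiftSize η)|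
        ≤ C * shiftSize η := by
  obtain ⟨C, r, hr, h⟩ := phi30_logCusp_nhds (BZBox_of_openBox hopen) (h28_pos_of_openBox hopen) hT hper
  obtain ⟨r₁, hr₁, hbox⟩ := BZBox_perturb_of_shiftSize_le hopen
  exact ⟨C, min r r₁, lt_min hr hr₁, fun η hY hYr =>
    h η hY (hYr.trans (min_le_left _ _)) (hbox η (hYr.trans (min_le_right _ _)))⟩

/-! ### Displacement geometry: `s₀ > 0`, the spread is a norm on the slice `{η₀ = 0}`, the sup norm -/

/-- `s₀(a) > 0` when all 28 forms of `a` are positive (`2s₀ = (s₀−s₁) + (s₀−s₂) + (s₁+s₂)`, three forms). -/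
theorem sParam_zero_pos {a : Dir} (hpos : ∀ k, 0 < h28 a k) : 0 < sParam a 0 := by
  obtain ⟨k₁, hk₁⟩ := exists_pairForm_sParam_eq a (show (0 : Fin 8) ≠ 1 by decide)
  obtain ⟨k₂, hk₂⟩ := exists_pairForm_sParam_eq a (show (0 : Fin 8) ≠ 2 by decide)
  obtain ⟨k₃, hk₃⟩ := exists_pairForm_sParam_eq a (show (1 : Fin 8) ≠ 2 by decide)
  have e : 2 * sParam a 0 = pairForm (sParam a) 0 1 + pairForm (sParam a) 0 2 + pairForm (sParam a) 1 2 := by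
    simp [pairForm]; ring
  have := hpos k₁; have := hpos k₂; have := hpos k₃
  linarith

/-- **ON THE SLICE THE SPREAD IS A NORM.** All 28 forms of `a` positive, `η₀ = 0`, `(m, M)` a slowest / fastest pair of
the rates of `η`: `Y(η) ≤ (x_max + 3x_max²/(2s₀))·(r_M(η) − r_m(η))`. (With `c = r_m(η)` and `S` the spread, every
form of `θ = η − c•s(a)` is `h_k·(r_k − c) ∈ [0, S·h_k]`, so `Y(θ) ≤ S·x_max`; `η₀ = 0` gives `|c|·s₀ = |θ₀| ≤
(3/2)·Y(θ)`; and `φ_k(η) = φ_k(θ) + c·h_k`.) In particular a slice displacement with spread `0` is `0`. -/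
theorem shiftSize_le_mul_spread_of_apply_zero {a : Dir} (hpos : ∀ k, 0 < h28 a k) {η : Fin 8 → ℝ} (h0 : η 0 = 0)
    {m M : Fin 28} (hmM : ∀ k, phiForm η m / h28 a m ≤ phiForm η k / h28 a k ∧
      phiForm η k / h28 a k ≤ phiForm η M / h28 a M) :
    shiftSize η ≤ (xMax a + 3 * xMax a ^ 2 / (2 * sParam a 0)) *
      (phiForm η M / h28 a M - phiForm η m / h28 a m) := by
  have hs0 := sParam_zero_pos hpos
  have hxM := xMax_pos hpos
  -- abbreviations: the slowest rate `c`, the spread `S`, the transversal part `θ = η − c•s(a)`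
  obtain ⟨c, hc⟩ : ∃ c : ℝ, c = phiForm η m / h28 a m := ⟨_, rfl⟩
  obtain ⟨S, hS⟩ : ∃ S : ℝ, S = phiForm η M / h28 a M - phiForm η m / h28 a m := ⟨_, rfl⟩
  rw [← hc] at hmM
  rw [← hS]
  have hS0 : 0 ≤ S := by rw [hS, ← hc]; linarith [(hmM M).1]
  obtain ⟨θ, hθ⟩ : ∃ θ : Fin 8 → ℝ, θ = η + (-c) • sParam a := ⟨_, rfl⟩
  have hφθ : ∀ k, phiForm θ k = phiForm η k - c * h28 a k := fun k => by
    rw [hθ, phiForm_add, phiForm_smul_sParam]; ring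
  -- every form of `θ` lies in `[0, S·h_k]`
  have hθk : ∀ k, |phiForm θ k| ≤ S * xMax a := by
    intro k
    have hk := hpos k
    have h1 : c ≤ phiForm η k / h28 a k := (hmM k).1
    have h2 : phiForm η k / h28 a k ≤ c + S := by rw [hS, ← hc]; linarith [(hmM k).2]
    rw [le_div_iff₀ hk] at h1
    rw [div_le_iff₀ hk] at h2
    rw [hφθ, abs_le]
    constructor
    · nlinarith [le_xMax a k]
    · nlinarith [le_xMax a k]
  have hYθ : shiftSize θ ≤ S * xMax a := Finset.sup'_le _ _ fun k _ => hθk k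
  -- `η₀ = 0` pins the radial coefficient
  have hθ0 : θ 0 = -c * sParam a 0 := by
    rw [hθ]; simp [h0]
  have hc0 : |c| * sParam a 0 ≤ 3 / 2 * (S * xMax a) := by
    have h := (abs_apply_zero_le_shiftSize θ).trans (mul_le_mul_of_nonneg_left hYθ (by norm_num))
    rwa [hθ0, abs_mul, abs_neg, abs_of_pos hs0] at h
  have hcle : |c| ≤ 3 * xMax a * S / (2 * sParam a 0) := by
    rw [le_div_iff₀ (by linarith)]; linarith
  -- reassemble `φ_k(η) = φ_k(θ) + c·h_k`
  refine Finset.sup'_le _ _ fun k _ => ?_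
  have hk := hpos k
  have e : phiForm η k = phiForm θ k + c * h28 a k := by rw [hφθ]; ring
  rw [e]
  refine (abs_add_le _ _).trans ?_
  rw [abs_mul, abs_of_pos hk]
  have h1 := hθk k
  have h2 : |c| * h28 a k ≤ 3 * xMax a * S / (2 * sParam a 0) * xMax a :=
    mul_le_mul hcle (le_xMax a k) hk.le (div_nonneg (by nlinarith) (by linarith))
  have e2 : (xMax a + 3 * xMax a ^ 2 / (2 * sParam a 0)) * S
      = S * xMax a + 3 * xMax a * S / (2 * sParam a 0) * xMax a := by
    field_simp
  rw [e2]
  exact add_le_add h1 h2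

/-- The sup norm of a displacement is controlled by its shift size: `‖η‖ ≤ (5/2)·Y(η)`. -/
theorem norm_le_shiftSize (η : Fin 8 → ℝ) : ‖η‖ ≤ 5 / 2 * shiftSize η := by
  refine (pi_norm_le_iff_of_nonneg (by have := shiftSize_nonneg η; positivity)).mpr fun i => ?_
  rw [Real.norm_eq_abs]
  refine Fin.cases ?_ (fun j => abs_apply_succ_le_shiftSize η j) i
  have := shiftSize_nonneg η
  linarith [abs_apply_zero_le_shiftSize η]

/-- The shift size is controlled by the sup norm: `Y(η) ≤ 2·‖η‖`. -/
theorem shiftSize_le_two_mul_norm (η : Fin 8 → ℝ) : shiftSize η ≤ 2 * ‖η‖ :=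
  Finset.sup'_le _ _ fun k _ => abs_phiForm_le_two_mul_norm η k

end Summit.KontsevichZagierPeriods.Zeta5Search.Barrier.ConeGamma

end
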